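import Mathlib.Analysis.Calculus.IteratedDeriv.Lemmas
import Mathlib.Analysis.Calculus.ContDiff.Basic
import Mathlib.Analysis.Calculus.LineDeriv.Basic
import Mathlib.Analysis.SpecialFunctions.ExpDeriv
import Mathlib.Algebra.MvPolynomial.PDeriv
import Mathlib.LinearAlgebra.Multilinear.Basis
import Literature.NumberTheory.Transcendental.LinGroup
import HarnessLib

/-!
# Invariant derivations on `𝔾ₐ^{d₀} × 𝔾ₘ^{d₁}`: flows, line jets, mixed jets, orders of vanishing

Topic `Literature/NumberTheory/Transcendental`. Everything here is PROVED (no named facts;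
definitions with bodies). It is the verbatim generalisation, from one additive factor to `d₀` of
them, of `PhilipponZeroEstimateOperators.lean` / `PhilipponZeroEstimateOrder.lean` (the group
`𝔾ₐ × 𝔾ₘ^m`, D. Roy's exposition of Philippon's zero estimate, LNM 1752 Ch. 11 §3) to the
vocabulary `Literature.NumberTheory.Transcendental.LinGroup` (`LinGroup.lean`): coordinates are
indexed by `Fin d₀ ⊕ Fin d₁`. These operators serve both results still owed to
`Literature.Barriers.Schanuel.roy1992_thm1` (`LinearSubgroupTheoremAssembly.lean`): the auxiliary
function (algebraicity and smallness of the jets of `w ↦ P(exp_G w)` along `W`) and the zero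
estimate with multiplicities on `𝔾ₐ^{d₀} × 𝔾ₘ^{d₁}`.

* `LinGroup.invDeriv w` — the invariant derivation
  `D_w = ∑ᵢ w₀ᵢ ∂/∂Xᵢ + ∑ₗ w₁ₗ Yₗ ∂/∂Yₗ` of `ℂ[X, Y]` attached to `w = (w₀, w₁) ∈ Lie G`
  (a `Derivation`), with `D_w Xᵢ = w₀ᵢ`, `D_w Yₗ = w₁ₗ Yₗ`, additivity and homogeneity in `w`;
* `LinGroup.flow z w t` — the curve `t ↦ (z₀ + t w₀, zₗ e^{t w₁ₗ})` through any point of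
  `ℂ^{d₀ + d₁}`, and **`hasDerivAt_eval_flow`**: `d/dt P(flow z w t) = (D_w P)(flow z w t)`
  (Roy, Lemma 3.1), `iteratedDeriv_eval_flow`: `d^k/dt^k P(flow z w t) = (D_w^k P)(flow z w t)`;
* `coord_mul_exp_add_smul` — `coord (g · exp_G(v + t u)) = flow (coord (g · exp_G v)) u t`;
  `contDiff_evalAt_mul_exp` — `w ↦ P(g · exp_G w)` is `C^ω`;
  **`iteratedDeriv_evalAt_mul_exp_line`** — `d^k/dt^k P(g exp_G(v + tu))|₀ = (D_u^k P)(g exp_G v)`;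
* `LinGroup.wordDeriv u P = D_{u₀} ⋯ D_{u_{k−1}} P` and **`iteratedFDeriv_evalAt_mul_exp_apply`**
  — mixed jets are values of words: `D^k f(v)(u) = (wordDeriv u P)(g exp_G v)`; the same for the
  restriction to a subspace `W` (`…_restrict_apply`);
* **`vanishesToOrder_iff_wordDeriv`** — `LinGroup.VanishesToOrder P W g N ↔` all words of length
  `< N` with letters in `W` kill `P` at `g`; **`vanishesToOrder_of_basis_words`** — it suffices to
  test the words whose letters run through a basis of `W` (`Basis.ext_multilinear`).

## References

* Yu. V. Nesterenko, P. Philippon (eds.), *Introduction to Algebraic Independence Theory*,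
  LNM 1752, Springer 2001, Ch. 11 (D. Roy), §3, Lemma 3.1, Def. 3.2, Lemma 3.3, Prop. 3.6 (iii).
  [NesterenkoPhilippon2001]
* P. Philippon, *Lemmes de zéros dans les groupes algébriques commutatifs*, Bull. Soc. Math.
  France 114 (1986), 355–383, §2 (`ord_g P`), §4.1. [Philippon1986]
-/

noncomputable section

open MvPolynomial Complex
open scoped ContDiff

namespace Literature.NumberTheory.Transcendental

namespace LinGroup

variable {d₀ d₁ : ℕ}

/-! ### Invariant derivations -/

/-- The invariant derivation attached to `w = (w₀, w₁) ∈ Lie G = ℂ^{d₀} × ℂ^{d₁}`: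
`D_w = ∑ᵢ w₀ᵢ ∂/∂Xᵢ + ∑ₗ w₁ₗ · Yₗ ∂/∂Yₗ`, i.e. `(D_w P)(h) = d/dt P(h · exp_G(t w))|_{t=0}`.
[cite: NesterenkoPhilippon2001, Ch. 11 Lemma 3.1] -/
def invDeriv (w : (Fin d₀ → ℂ) × (Fin d₁ → ℂ)) :
    Derivation ℂ (MvPolynomial (Fin d₀ ⊕ Fin d₁) ℂ) (MvPolynomial (Fin d₀ ⊕ Fin d₁) ℂ) :=
  ∑ i : Fin d₀, w.1 i • pderiv (Sum.inl i) +
    ∑ l : Fin d₁, w.2 l • ((X (Sum.inr l) : MvPolynomial (Fin d₀ ⊕ Fin d₁) ℂ) • pderiv (Sum.inr l))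

/-- Pointwise evaluation of a finite sum of derivations. [folklore] -/
theorem sum_derivation_apply {ι : Type*} (s : Finset ι)
    (D : ι → Derivation ℂ (MvPolynomial (Fin d₀ ⊕ Fin d₁) ℂ) (MvPolynomial (Fin d₀ ⊕ Fin d₁) ℂ))
    (P : MvPolynomial (Fin d₀ ⊕ Fin d₁) ℂ) : (∑ j ∈ s, D j) P = ∑ j ∈ s, D j P := by
  classical
  induction s using Finset.induction_on with
  | empty => simp
  | insert a s ha ih => rw [Finset.sum_insert ha, Finset.sum_insert ha, Derivation.add_apply, ih]

/-- The formula `D_w P = ∑ᵢ w₀ᵢ ∂P/∂Xᵢ + ∑ₗ w₁ₗ Yₗ ∂P/∂Yₗ`. [folklore] -/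
theorem invDeriv_apply (w : (Fin d₀ → ℂ) × (Fin d₁ → ℂ)) (P : MvPolynomial (Fin d₀ ⊕ Fin d₁) ℂ) :
    invDeriv w P = ∑ i : Fin d₀, w.1 i • pderiv (Sum.inl i) P +
      ∑ l : Fin d₁, w.2 l • (X (Sum.inr l) * pderiv (Sum.inr l) P) := by
  simp only [invDeriv, Derivation.add_apply, Derivation.smul_apply, sum_derivation_apply,
    smul_eq_mul]

/-- `D_w Xᵢ = w₀ᵢ` (a constant). [folklore] -/
@[simp] theorem invDeriv_X_inl (w : (Fin d₀ → ℂ) × (Fin d₁ → ℂ)) (i : Fin d₀) :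
    invDeriv w (X (Sum.inl i) : MvPolynomial (Fin d₀ ⊕ Fin d₁) ℂ) = C (w.1 i) := by
  classical
  rw [invDeriv_apply]
  have h0 : ∀ i' : Fin d₀, pderiv (Sum.inl i') (X (Sum.inl i) : MvPolynomial (Fin d₀ ⊕ Fin d₁) ℂ) =
      if i' = i then 1 else 0 := fun i' => by
    rw [pderiv_X]
    simp [Pi.single_apply, eq_comm]
  have h1 : ∀ l : Fin d₁, pderiv (Sum.inr l) (X (Sum.inl i) : MvPolynomial (Fin d₀ ⊕ Fin d₁) ℂ) = 0 :=
    fun l => by rw [pderiv_X]; simp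
  simp_rw [h0, h1, mul_zero, smul_zero, Finset.sum_const_zero, add_zero, smul_ite, smul_zero]
  rw [Finset.sum_ite_eq' Finset.univ i]
  simp [MvPolynomial.smul_eq_C_mul]

/-- `D_w Yₗ = w₁ₗ Yₗ`. [folklore] -/
@[simp] theorem invDeriv_X_inr (w : (Fin d₀ → ℂ) × (Fin d₁ → ℂ)) (l : Fin d₁) :
    invDeriv w (X (Sum.inr l) : MvPolynomial (Fin d₀ ⊕ Fin d₁) ℂ) = C (w.2 l) * X (Sum.inr l) := by
  classical
  rw [invDeriv_apply]
  have h0 : ∀ i : Fin d₀, pderiv (Sum.inl i) (X (Sum.inr l) : MvPolynomial (Fin d₀ ⊕ Fin d₁) ℂ) = 0 :=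
    fun i => by rw [pderiv_X]; simp
  have h1 : ∀ l' : Fin d₁, pderiv (Sum.inr l') (X (Sum.inr l) : MvPolynomial (Fin d₀ ⊕ Fin d₁) ℂ) =
      if l' = l then 1 else 0 := fun l' => by
    rw [pderiv_X]
    simp [Pi.single_apply, eq_comm]
  simp_rw [h0, h1, smul_zero, Finset.sum_const_zero, zero_add, mul_ite, mul_one, mul_zero,
    smul_ite, smul_zero]
  rw [Finset.sum_ite_eq' Finset.univ l]
  simp [MvPolynomial.smul_eq_C_mul]

/-- `D_w` kills constants. [folklore] -/
@[simp] theorem invDeriv_C (w : (Fin d₀ → ℂ) × (Fin d₁ → ℂ)) (a : ℂ) :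
    invDeriv w (C a : MvPolynomial (Fin d₀ ⊕ Fin d₁) ℂ) = 0 := by
  rw [← MvPolynomial.algebraMap_eq]
  exact (invDeriv w).map_algebraMap a

/-- `w ↦ D_w` is additive. [folklore] -/
theorem invDeriv_add (w w' : (Fin d₀ → ℂ) × (Fin d₁ → ℂ)) :
    invDeriv (d₀ := d₀) (d₁ := d₁) (w + w') = invDeriv w + invDeriv w' := by
  ext P : 1
  simp only [invDeriv_apply, Derivation.add_apply, Prod.fst_add, Prod.snd_add, Pi.add_apply,
    add_smul, Finset.sum_add_distrib]
  abel

/-- `w ↦ D_w` is homogeneous. [folklore] -/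
theorem invDeriv_smul (c : ℂ) (w : (Fin d₀ → ℂ) × (Fin d₁ → ℂ)) :
    invDeriv (d₀ := d₀) (d₁ := d₁) (c • w) = c • invDeriv w := by
  ext P : 1
  simp only [invDeriv_apply, Derivation.smul_apply, Prod.smul_fst, Prod.smul_snd, Pi.smul_apply,
    smul_eq_mul, mul_smul, Finset.smul_sum, smul_add]

/-! ### Flows: the one-parameter subgroups through an arbitrary point of `ℂ^{d₀ + d₁}` -/

/-- The curve `t ↦ (z₀ + t w₀, (zₗ e^{t w₁ₗ})ₗ)` — the orbit of the point `z ∈ ℂ^{d₀+d₁}` under the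
one-parameter subgroup `t ↦ exp_G(t w)`. [folklore] -/
def flow (z : Fin d₀ ⊕ Fin d₁ → ℂ) (w : (Fin d₀ → ℂ) × (Fin d₁ → ℂ)) (t : ℂ) : Fin d₀ ⊕ Fin d₁ → ℂ :=
  Sum.elim (fun i => z (Sum.inl i) + t * w.1 i) (fun l => z (Sum.inr l) * Complex.exp (t * w.2 l))

/-- The additive coordinates of the flow. [folklore] -/
@[simp] theorem flow_apply_inl (z : Fin d₀ ⊕ Fin d₁ → ℂ) (w : (Fin d₀ → ℂ) × (Fin d₁ → ℂ)) (t : ℂ)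
    (i : Fin d₀) : flow z w t (Sum.inl i) = z (Sum.inl i) + t * w.1 i := rfl

/-- The multiplicative coordinates of the flow. [folklore] -/
@[simp] theorem flow_apply_inr (z : Fin d₀ ⊕ Fin d₁ → ℂ) (w : (Fin d₀ → ℂ) × (Fin d₁ → ℂ)) (t : ℂ)
    (l : Fin d₁) : flow z w t (Sum.inr l) = z (Sum.inr l) * Complex.exp (t * w.2 l) := rfl

/-- At `t = 0` the flow is at `z`. [folklore] -/
@[simp] theorem flow_zero (z : Fin d₀ ⊕ Fin d₁ → ℂ) (w : (Fin d₀ → ℂ) × (Fin d₁ → ℂ)) :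
    flow z w 0 = z := by
  funext v
  rcases v with i | l <;> simp

/-- Derivative of an additive coordinate of the flow. [folklore] -/
theorem hasDerivAt_flow_inl (z : Fin d₀ ⊕ Fin d₁ → ℂ) (w : (Fin d₀ → ℂ) × (Fin d₁ → ℂ)) (t : ℂ)
    (i : Fin d₀) : HasDerivAt (fun s => flow z w s (Sum.inl i)) (w.1 i) t := by
  simp only [flow_apply_inl]
  have h := ((hasDerivAt_id' t).mul_const (w.1 i)).const_add (z (Sum.inl i))
  rw [one_mul] at h
  exact h

/-- Derivative of a multiplicative coordinate of the flow. [folklore] -/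
theorem hasDerivAt_flow_inr (z : Fin d₀ ⊕ Fin d₁ → ℂ) (w : (Fin d₀ → ℂ) × (Fin d₁ → ℂ)) (t : ℂ)
    (l : Fin d₁) :
    HasDerivAt (fun s => flow z w s (Sum.inr l)) (w.2 l * flow z w t (Sum.inr l)) t := by
  simp only [flow_apply_inr]
  have h1 : HasDerivAt (fun s : ℂ => s * w.2 l) (w.2 l) t := by
    have h := (hasDerivAt_id' t).mul_const (w.2 l)
    rwa [one_mul] at h
  have h3 := (h1.cexp).const_mul (z (Sum.inr l))
  exact h3.congr_deriv (by ring)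

/-- **Derivative along the flow = invariant derivation** (Roy, LNM 1752 Ch. 11, Lemma 3.1, explicit
for `𝔾ₐ^{d₀} × 𝔾ₘ^{d₁}`): `d/dt P(flow z w t) = (D_w P)(flow z w t)`.
[cite: NesterenkoPhilippon2001, Ch. 11 Lemma 3.1] -/
theorem hasDerivAt_eval_flow (P : MvPolynomial (Fin d₀ ⊕ Fin d₁) ℂ) (z : Fin d₀ ⊕ Fin d₁ → ℂ)
    (w : (Fin d₀ → ℂ) × (Fin d₁ → ℂ)) (t : ℂ) :
    HasDerivAt (fun s => eval (flow z w s) P) (eval (flow z w t) (invDeriv w P)) t := by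
  induction P using MvPolynomial.induction_on with
  | C a =>
    simp only [eval_C, invDeriv_C, map_zero]
    exact hasDerivAt_const t a
  | add p q hp hq =>
    simp only [map_add]
    exact hp.add hq
  | mul_X p v hp =>
    have key : ∀ s, eval (flow z w s) (p * X v) = eval (flow z w s) p * flow z w s v := fun s => by
      simp only [map_mul, eval_X]
    simp_rw [key]
    simp only [Derivation.leibniz, smul_eq_mul, map_add, map_mul, eval_X]
    rcases v with i | l
    · simp only [invDeriv_X_inl, eval_C]
      exact (hp.mul (hasDerivAt_flow_inl z w t i)).congr_deriv (by ring)
    · simp only [invDeriv_X_inr, map_mul, eval_C, eval_X]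
      exact (hp.mul (hasDerivAt_flow_inr z w t l)).congr_deriv (by ring)

/-- `deriv` form of `hasDerivAt_eval_flow`. [folklore] -/
theorem deriv_eval_flow (P : MvPolynomial (Fin d₀ ⊕ Fin d₁) ℂ) (z : Fin d₀ ⊕ Fin d₁ → ℂ)
    (w : (Fin d₀ → ℂ) × (Fin d₁ → ℂ)) :
    deriv (fun s => eval (flow z w s) P) = fun t => eval (flow z w t) (invDeriv w P) :=
  funext fun t => (hasDerivAt_eval_flow P z w t).deriv

/-- **Iterated derivatives along the flow**: `d^k/dt^k P(flow z w t) = (D_w^k P)(flow z w t)`.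
[cite: NesterenkoPhilippon2001, Ch. 11 Lemma 3.3] -/
theorem iteratedDeriv_eval_flow (k : ℕ) (P : MvPolynomial (Fin d₀ ⊕ Fin d₁) ℂ)
    (z : Fin d₀ ⊕ Fin d₁ → ℂ) (w : (Fin d₀ → ℂ) × (Fin d₁ → ℂ)) (t : ℂ) :
    iteratedDeriv k (fun s => eval (flow z w s) P) t = eval (flow z w t) ((invDeriv w)^[k] P) := by
  induction k generalizing P t with
  | zero => simp
  | succ k ih =>
    rw [iteratedDeriv_succ', Function.iterate_succ_apply]
    rw [deriv_eval_flow]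
    exact ih (invDeriv w P) t

/-! ### Flows and the analytic subgroups `exp_G(W)` -/

/-- Along the analytic subgroups: `coord (g · exp_G(v + t u)) = flow (coord (g · exp_G v)) u t`.
[folklore] -/
theorem coord_mul_exp_add_smul (g : LinGroup d₀ d₁) (v u : (Fin d₀ → ℂ) × (Fin d₁ → ℂ)) (t : ℂ) :
    coord (g * exp (v + t • u)) = flow (coord (g * exp v)) u t := by
  funext x
  rcases x with i | l
  · simp only [coord_inl, Prod.fst_mul, toAdd_mul, flow_apply_inl, toAdd_exp_fst, Prod.fst_add,
      Prod.smul_fst, Pi.add_apply, Pi.smul_apply, smul_eq_mul]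
    ring
  · simp only [coord_inr, Prod.snd_mul, Pi.mul_apply, Units.val_mul, coe_exp_snd, flow_apply_inr,
      Prod.snd_add, Prod.smul_snd, Pi.add_apply, Pi.smul_apply, smul_eq_mul, Complex.exp_add]
    ring

/-- Coordinates of `g · exp_G(v)`. [folklore] -/
theorem coord_mul_exp (g : LinGroup d₀ d₁) (v : (Fin d₀ → ℂ) × (Fin d₁ → ℂ)) :
    coord (g * exp v) = Sum.elim (fun i => Multiplicative.toAdd g.1 i + v.1 i)
      (fun l => ((g.2 l : ℂˣ) : ℂ) * Complex.exp (v.2 l)) := by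
  have h := coord_mul_exp_add_smul g v 0 0
  simp only [smul_zero, add_zero] at h
  rw [h]
  funext x
  rcases x with i | l <;> simp [flow, exp]

/-- **`w ↦ P(g · exp_G w)` is analytic (`C^ω`) on `Lie G`.** [folklore] -/
theorem contDiff_evalAt_mul_exp (P : MvPolynomial (Fin d₀ ⊕ Fin d₁) ℂ) (g : LinGroup d₀ d₁)
    {n : WithTop ℕ∞} :
    ContDiff ℂ n fun v : (Fin d₀ → ℂ) × (Fin d₁ → ℂ) => evalAt P (g * exp v) := by
  simp only [evalAt, coord_mul_exp]
  induction P using MvPolynomial.induction_on with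
  | C a => simpa using contDiff_const
  | add p q hp hq => simpa using hp.add hq
  | mul_X p x hp =>
    simp only [map_mul, eval_X]
    refine hp.mul ?_
    rcases x with i | l
    · simp only [Sum.elim_inl]
      exact contDiff_const.add ((contDiff_apply ℂ ℂ i).comp contDiff_fst)
    · simp only [Sum.elim_inr]
      exact contDiff_const.mul ((contDiff_apply ℂ ℂ l).comp contDiff_snd).cexp

/-- **Line jets along the analytic subgroup are values of iterated invariant derivations**:
`d^k/dt^k P(g · exp_G(v + t u))|_{t=0} = (D_u^k P)(g · exp_G v)`.
[cite: NesterenkoPhilippon2001, Ch. 11 Lemma 3.3] -/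
theorem iteratedDeriv_evalAt_mul_exp_line (P : MvPolynomial (Fin d₀ ⊕ Fin d₁) ℂ) (g : LinGroup d₀ d₁)
    (v u : (Fin d₀ → ℂ) × (Fin d₁ → ℂ)) (k : ℕ) :
    iteratedDeriv k (fun t : ℂ => evalAt P (g * exp (v + t • u))) 0 =
      evalAt ((invDeriv u)^[k] P) (g * exp v) := by
  have h : (fun t : ℂ => evalAt P (g * exp (v + t • u))) =
      fun t => eval (flow (coord (g * exp v)) u t) P := by
    funext t
    simp only [evalAt, coord_mul_exp_add_smul]
  rw [h, iteratedDeriv_eval_flow, flow_zero, evalAt]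

/-! ### Words of invariant derivations and mixed jets -/

/-- The word `D_{u₀} ∘ D_{u₁} ∘ ⋯ ∘ D_{u_{k-1}}` applied to `P` (the last vector acts first).
[folklore] -/
def wordDeriv : {k : ℕ} → (Fin k → (Fin d₀ → ℂ) × (Fin d₁ → ℂ)) → MvPolynomial (Fin d₀ ⊕ Fin d₁) ℂ →
    MvPolynomial (Fin d₀ ⊕ Fin d₁) ℂ
  | 0, _, P => P
  | _ + 1, u, P => wordDeriv (Fin.init u) (invDeriv (u (Fin.last _)) P)

/-- The empty word is the identity. [folklore] -/
@[simp] theorem wordDeriv_zero (u : Fin 0 → (Fin d₀ → ℂ) × (Fin d₁ → ℂ))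
    (P : MvPolynomial (Fin d₀ ⊕ Fin d₁) ℂ) : wordDeriv u P = P := rfl

/-- Recursion of words. [folklore] -/
theorem wordDeriv_succ {k : ℕ} (u : Fin (k + 1) → (Fin d₀ → ℂ) × (Fin d₁ → ℂ))
    (P : MvPolynomial (Fin d₀ ⊕ Fin d₁) ℂ) :
    wordDeriv u P = wordDeriv (Fin.init u) (invDeriv (u (Fin.last k)) P) := rfl

/-- A constant word is an iterate: `wordDeriv (u, …, u) P = D_u^k P`. [folklore] -/
theorem wordDeriv_const (k : ℕ) (u : (Fin d₀ → ℂ) × (Fin d₁ → ℂ)) (P : MvPolynomial (Fin d₀ ⊕ Fin d₁) ℂ) :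
    wordDeriv (fun _ : Fin k => u) P = (invDeriv u)^[k] P := by
  induction k generalizing P with
  | zero => rfl
  | succ k ih =>
    rw [wordDeriv_succ, Function.iterate_succ_apply]
    exact ih (invDeriv u P)

/-- Words kill `0`. [folklore] -/
@[simp] theorem wordDeriv_zero_right {k : ℕ} (u : Fin k → (Fin d₀ → ℂ) × (Fin d₁ → ℂ)) :
    wordDeriv u (0 : MvPolynomial (Fin d₀ ⊕ Fin d₁) ℂ) = 0 := by
  induction k with
  | zero => rfl
  | succ k ih => rw [wordDeriv_succ, map_zero, ih]

/-- Words are additive in `P`. [folklore] -/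
theorem wordDeriv_add {k : ℕ} (u : Fin k → (Fin d₀ → ℂ) × (Fin d₁ → ℂ))
    (Q R : MvPolynomial (Fin d₀ ⊕ Fin d₁) ℂ) : wordDeriv u (Q + R) = wordDeriv u Q + wordDeriv u R := by
  induction k generalizing Q R with
  | zero => rfl
  | succ k ih => rw [wordDeriv_succ, wordDeriv_succ, wordDeriv_succ, map_add, ih]

/-- Words are homogeneous in `P`. [folklore] -/
theorem wordDeriv_smul {k : ℕ} (u : Fin k → (Fin d₀ → ℂ) × (Fin d₁ → ℂ)) (c : ℂ)
    (Q : MvPolynomial (Fin d₀ ⊕ Fin d₁) ℂ) : wordDeriv u (c • Q) = c • wordDeriv u Q := by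
  induction k generalizing Q with
  | zero => rfl
  | succ k ih => rw [wordDeriv_succ, wordDeriv_succ, Derivation.map_smul, ih]

/-- The Fréchet derivative of `w ↦ P(g · exp_G w)` in the direction `e` is `w ↦ (D_e P)(g · exp_G w)`.
[folklore] -/
theorem fderiv_evalAt_mul_exp_apply (P : MvPolynomial (Fin d₀ ⊕ Fin d₁) ℂ) (g : LinGroup d₀ d₁)
    (y e : (Fin d₀ → ℂ) × (Fin d₁ → ℂ)) :
    fderiv ℂ (fun v : (Fin d₀ → ℂ) × (Fin d₁ → ℂ) => evalAt P (g * exp v)) y e =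
      evalAt (invDeriv e P) (g * exp y) := by
  have hd : DifferentiableAt ℂ (fun v : (Fin d₀ → ℂ) × (Fin d₁ → ℂ) => evalAt P (g * exp v)) y :=
    ((contDiff_evalAt_mul_exp P g (n := 1)).differentiable one_ne_zero).differentiableAt
  rw [← hd.lineDeriv_eq_fderiv]
  have h := iteratedDeriv_evalAt_mul_exp_line P g y e 1
  rw [iteratedDeriv_one, Function.iterate_one] at h
  exact h

/-- **Mixed jets are values of words of invariant derivations**: for `f(w) = P(g · exp_G w)`,
`D^k f(v)(u₀, …, u_{k-1}) = (D_{u₀} ⋯ D_{u_{k-1}} P)(g · exp_G v)`. [folklore] -/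
theorem iteratedFDeriv_evalAt_mul_exp_apply (k : ℕ) (P : MvPolynomial (Fin d₀ ⊕ Fin d₁) ℂ)
    (g : LinGroup d₀ d₁) (v : (Fin d₀ → ℂ) × (Fin d₁ → ℂ)) (u : Fin k → (Fin d₀ → ℂ) × (Fin d₁ → ℂ)) :
    iteratedFDeriv ℂ k (fun w : (Fin d₀ → ℂ) × (Fin d₁ → ℂ) => evalAt P (g * exp w)) v u =
      evalAt (wordDeriv u P) (g * exp v) := by
  induction k generalizing P v with
  | zero => simp
  | succ k ih =>
    rw [iteratedFDeriv_succ_apply_right, wordDeriv_succ]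
    set e := u (Fin.last k) with he
    have hF : ContDiff ℂ ω (fderiv ℂ fun w : (Fin d₀ → ℂ) × (Fin d₁ → ℂ) => evalAt P (g * exp w)) :=
      (contDiff_evalAt_mul_exp P g).fderiv_right le_rfl
    have hcomp : (fun y : (Fin d₀ → ℂ) × (Fin d₁ → ℂ) =>
        fderiv ℂ (fun w => evalAt P (g * exp w)) y e) =
        (ContinuousLinearMap.apply ℂ ℂ e) ∘ fderiv ℂ (fun w => evalAt P (g * exp w)) := by
      funext y
      simp
    have h1 : iteratedFDeriv ℂ k (fun y => fderiv ℂ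
          (fun w : (Fin d₀ → ℂ) × (Fin d₁ → ℂ) => evalAt P (g * exp w)) y) v (Fin.init u) e =
        iteratedFDeriv ℂ k (fun y => fderiv ℂ
          (fun w : (Fin d₀ → ℂ) × (Fin d₁ → ℂ) => evalAt P (g * exp w)) y e) v (Fin.init u) := by
      rw [hcomp, ContinuousLinearMap.iteratedFDeriv_comp_left _ hF.contDiffAt
        (le_top : (k : WithTop ℕ∞) ≤ ω)]
      simp
    rw [h1]
    have h2 : (fun y => fderiv ℂ (fun w : (Fin d₀ → ℂ) × (Fin d₁ → ℂ) => evalAt P (g * exp w)) y e) =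
        fun y => evalAt (invDeriv e P) (g * exp y) :=
      funext fun y => fderiv_evalAt_mul_exp_apply P g y e
    rw [h2, ih]

/-- The same for the restriction to a subspace `W ⊆ Lie G` (the function of
`LinGroup.VanishesToOrder`). [folklore] -/
theorem iteratedFDeriv_evalAt_mul_exp_restrict_apply (k : ℕ) (P : MvPolynomial (Fin d₀ ⊕ Fin d₁) ℂ)
    (g : LinGroup d₀ d₁) (W : Submodule ℂ ((Fin d₀ → ℂ) × (Fin d₁ → ℂ))) (v : W) (u : Fin k → W) :
    iteratedFDeriv ℂ k (fun w : W => evalAt P (g * exp (w : (Fin d₀ → ℂ) × (Fin d₁ → ℂ)))) v u =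
      evalAt (wordDeriv (fun i => (u i : (Fin d₀ → ℂ) × (Fin d₁ → ℂ))) P)
        (g * exp (v : (Fin d₀ → ℂ) × (Fin d₁ → ℂ))) := by
  have hcomp : (fun w : W => evalAt P (g * exp (w : (Fin d₀ → ℂ) × (Fin d₁ → ℂ)))) =
      (fun w : (Fin d₀ → ℂ) × (Fin d₁ → ℂ) => evalAt P (g * exp w)) ∘ W.subtypeL := funext fun w => rfl
  rw [hcomp, ContinuousLinearMap.iteratedFDeriv_comp_right _ (contDiff_evalAt_mul_exp P g) _
    (le_top : (k : WithTop ℕ∞) ≤ ω), ContinuousMultilinearMap.compContinuousLinearMap_apply,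
    iteratedFDeriv_evalAt_mul_exp_apply]
  rfl

/-! ### The dictionary with the order of vanishing -/

/-- **Order of vanishing along `exp_G(W)` in terms of words**: `P` vanishes to order `≥ N` at `g`
along `exp_G(W)` iff `(D_{u₀} ⋯ D_{u_{k-1}} P)(g) = 0` for all `k < N` and all letters `uᵢ ∈ W`.
[cite: NesterenkoPhilippon2001, Ch. 11 Prop. 3.6 (iii)] -/
theorem vanishesToOrder_iff_wordDeriv (P : MvPolynomial (Fin d₀ ⊕ Fin d₁) ℂ)
    (W : Submodule ℂ ((Fin d₀ → ℂ) × (Fin d₁ → ℂ))) (g : LinGroup d₀ d₁) (N : ℕ) :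
    VanishesToOrder P W g N ↔
      ∀ k < N, ∀ u : Fin k → (Fin d₀ → ℂ) × (Fin d₁ → ℂ), (∀ i, u i ∈ W) →
        evalAt (wordDeriv u P) g = 0 := by
  constructor
  · intro h k hk u hu
    have h0 : iteratedFDeriv ℂ k
        (fun w : W => evalAt P (g * exp (w : (Fin d₀ → ℂ) × (Fin d₁ → ℂ)))) 0 = 0 := h k hk
    have h1 : iteratedFDeriv ℂ k
        (fun w : W => evalAt P (g * exp (w : (Fin d₀ → ℂ) × (Fin d₁ → ℂ)))) 0
        (fun i => ⟨u i, hu i⟩) = 0 := by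
      rw [h0]
      rfl
    rw [iteratedFDeriv_evalAt_mul_exp_restrict_apply] at h1
    simpa using h1
  · intro h k hk
    ext u
    rw [iteratedFDeriv_evalAt_mul_exp_restrict_apply]
    simpa using h k hk (fun i => (u i : (Fin d₀ → ℂ) × (Fin d₁ → ℂ))) (fun i => (u i).2)

/-- **Words on a basis suffice**: `P` vanishes to order `≥ N` at `g` along `exp_G(W)` as soon as
`(D_{b(v₀)} ⋯ D_{b(v_{k-1})} P)(g) = 0` for all `k < N` and all choices `v : Fin k → ι` of basis
vectors `b` of `W` (a multilinear map vanishing on basis tuples vanishes, `Basis.ext_multilinear`).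
[folklore] -/
theorem vanishesToOrder_of_basis_words (P : MvPolynomial (Fin d₀ ⊕ Fin d₁) ℂ)
    (W : Submodule ℂ ((Fin d₀ → ℂ) × (Fin d₁ → ℂ))) (g : LinGroup d₀ d₁) (N : ℕ)
    {ι : Type*} [Finite ι] (b : Module.Basis ι ℂ W)
    (h : ∀ k < N, ∀ v : Fin k → ι,
      evalAt (wordDeriv (fun i => (b (v i) : (Fin d₀ → ℂ) × (Fin d₁ → ℂ))) P) g = 0) :
    VanishesToOrder P W g N := by
  intro k hk
  have key : (iteratedFDeriv ℂ k
      (fun w : W => evalAt P (g * exp (w : (Fin d₀ → ℂ) × (Fin d₁ → ℂ)))) 0).toMultilinearMap =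
      (0 : ContinuousMultilinearMap ℂ (fun _ : Fin k => W) ℂ).toMultilinearMap := by
    refine Module.Basis.ext_multilinear (fun _ => b) fun v => ?_
    rw [ContinuousMultilinearMap.coe_coe, ContinuousMultilinearMap.coe_coe,
      iteratedFDeriv_evalAt_mul_exp_restrict_apply]
    simpa using h k hk v
  exact ContinuousMultilinearMap.toMultilinearMap_injective key

end LinGroup

end Literature.NumberTheory.Transcendental
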